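import Summits.BirchSwinnertonDyer.BirchSwinnertonDyer.Theorems.EisensteinPrimesMazurMCOnCellBTwistbackSubrowPartnerAnyLine
import Summits.BirchSwinnertonDyer.BirchSwinnertonDyer.Theorems.EisensteinPrimesLineCharactersUnramifiedAtMultiplicativePlace
import HarnessLib

/-!
# Crux 3 `MazurMCOnCellB` (stmt-BirchSwinnertonDyer-19033), line `twistback` v4 — the sub-row door with the local
# balance REDUCED: stub 6 (∃-PARTNER) at a non-split X2b pair `(W, 3)` from a rational `3`-line and the identity
# `1 = Σ_{ℓ ∈ S₀ split multiplicative} s_ℓ + Σ_{ℓ ∈ S₀ additive, ℓ ∤ m} s_ℓ([φ(ℓ) = ℓ̄] + [ψ(ℓ) = ℓ̄])`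

Width seat bsd-line-x2-p1-w3 (gen 10), cell `bsd-eis` (run/shared/lean/pub/bsd-eis/), 2026-08-28. HONEST FRAMING:
conditional theorems only; named facts BY NAME exactly as in LEAD bsd-line-x2-p1 g11's
`…TwistbackSubrowPartnerAnyLine.upperPartner_at_three_of_line_of_thmE` (p655437): the route's `PublishedInputs`
(stmt-…-19037), Disegni 2020 Thm. 4(1), Greenberg–Vatsal Thm. (3.11), Dokchitser–Dokchitser Thm. 1.4,
Nakagawa–Horie–Taya (all PUBLISHED) and Keller–Yin Thm. E (`thmE_pConverse_semistable_OPEN`, UNREFEREED PREPRINT —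
every `_of_thmE` theorem is conditional on it). `--supports` stmt-BirchSwinnertonDyer-19033; no `def`, no `sorry`;
closes no registered stub (stub 6 quantifies over ALL X2b pairs); no summit statement, no Mazur main conjecture and no
BSD is proved for any curve unconditionally; 0 cells / labels / tiers move.

WHAT. LEAD g11's door takes the balance `1 + Σ_{v ∈ S₀} δ_W^{(v)} = Σ_{v ∈ S₀} (s_ℓ[φ(ℓ) = ℓ̄] + s_ℓ[ψ(ℓ) = ℓ̄])` RAW
(`S₀ ∌ (3)` any finite set of places off which `W` is good). For `S₀` = the bad places `≠ 3`, split as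
MULTIPLICATIVE places and ADDITIVE places `A`, this file evaluates everything that is class-wide:

* at a multiplicative `v ∤ 3` the summand is `δ + s_ℓ·[split]` with NO side condition (width seat w3 g10's
  `…LineCharactersUnramifiedAtMultiplicativePlace.balanceTerm_eq_at_three`, p656908: the line characters are
  unramified there — unipotent inertia, x1-p1-w2 g5; ℓ = 2 included);
* at an additive `v` with `ℓ ∣ m` BOTH characters ramify (`ℓ ∣ d` too: w7's `dvd_iff_dvd_of_isPrimitive`, Weil
  relation) and the summand is `0 = δ` (w7's `balanceTerm_of_hasAdditiveReductionAt_of_dvd`, `δ = 0` at an additive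
  place, `X2/LocalDeltaCalculus`);
* at an additive `v` with `ℓ ∤ m` (inertia of order `3` at `ℓ`, Kodaira IV / IV*: the characters are unramified at
  `ℓ`) the summand stays RAW: `s_ℓ([φ(ℓ) = ℓ̄] + [ψ(ℓ) = ℓ̄])`, `δ = 0`.

So: §1 `balanceTerm_eq_zero_of_hasAdditiveReductionAt_of_dvd` (general `p`); §2 **`balance_iff_reduced_at_three`** —
`1 + Σ_{S₀} δ = Σ_{S₀} term ↔ 1 = Σ_{v ∈ S₀ ∖ A} s_ℓ·[split] + Σ_{v ∈ A, ℓ ∤ m} term(v)`; §3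
**`upperPartner_at_three_of_reducedBalance_of_thmE`** — the conclusion of `stub_upperPartner` at `(W, 3)` VERBATIM from
`X2.CellB W 3`, `3` non-split, ANY rational `3`-line with primitive presenting characters `(φ mod m, ψ mod d)`, a
finite `S₀ ∌ (3)` off which `W` is good, a subset `A ⊆ S₀` of additive places outside which `S₀` is multiplicative,
and the REDUCED balance. Per pair, what is left to supply is: the line datum (its presenting characters — the X3
certificate files' currency), `S₀`/`A` from the conductor, and ONE numerical identity in which only the split
multiplicative primes (`s_ℓ = 3^{v₃(ℓ²−1)−1}`) and the additive primes `ℓ ∤ m` appear. By w3 g10's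
`…NonsplitHasAdditivePlace` (`A ≠ ∅` on this sub-row) the additive part never disappears entirely.

References: [GreenbergVatsal2000] §2 Prop. (2.4) (p. 22), pp. 26–28, §3 Thm. (3.11) (p. 43); [KellerYin2024] Thm. E
(PRE); [NakagawaHorie1988] Thm. 1; [Disegni2020] Thm. 4; [DokchitserDokchitserAnnals2010] Thm. 1.4; [Wuthrich2014]
Thm. 16.
-/

set_option autoImplicit false
-- `Summit.BirchSwinnertonDyer.BirchSwinnertonDyer.…`: the summit and its single sub-problem share a name.
set_option linter.dupNamespace false

noncomputable section

open scoped Classical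

open NumberField IsDedekindDomain Field WeierstrassCurve DirichletCharacter
  Literature.NumberTheory.EllipticCurves Literature.NumberTheory.GaloisRepresentations
  Literature.NumberTheory.EllipticCurves.GreenbergVatsal2000
  Literature.NumberTheory.EllipticCurves.Rank1Residual Literature.NumberTheory.EllipticCurves.Rank1Residual.Typed
  Literature.NumberTheory.EllipticCurves.Disegni2020 Literature.NumberTheory.EllipticCurves.KellerYin2024
  Summit.BirchSwinnertonDyer.Rank1Residual Summit.BirchSwinnertonDyer.Rank1Residual.X2
  Summit.BirchSwinnertonDyer.BirchSwinnertonDyer.Theses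
  Summit.BirchSwinnertonDyer.BirchSwinnertonDyer.Theorems.EisensteinPrimesLineCharactersWeilRelation
  Summit.BirchSwinnertonDyer.BirchSwinnertonDyer.Theorems.EisensteinPrimesLocalBalanceAtMultiplicativePlace
  Summit.BirchSwinnertonDyer.BirchSwinnertonDyer.Theorems.EisensteinPrimesLineCharactersUnramifiedAtMultiplicativePlace
  Summit.BirchSwinnertonDyer.BirchSwinnertonDyer.Theorems.EisensteinPrimesMazurMCOnCellBTwistbackSubrowPartnerAnyLine

namespace Summit.BirchSwinnertonDyer.BirchSwinnertonDyer.Theorems.EisensteinPrimesMazurMCOnCellBTwistbackSubrowReducedBalance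

variable {W : WeierstrassCurve ℚ} [W.IsElliptic] {p : ℕ} [hp : Fact p.Prime]

/-! ## §1. An additive place where the line character ramifies contributes nothing -/

/-- **ADDITIVE `v = (ℓ)`, `ℓ ∤ p`, with `ℓ ∣ m`: the door's balance term at `v` is `0`, and so is `δ_W^{(v)}`.**
`ℓ ∣ m` forces `ℓ ∣ d` (the two presenting characters ramify at the same primes `≠ p`: w7's
`dvd_iff_dvd_of_isPrimitive`), both indicator terms vanish (w7's `balanceTerm_of_hasAdditiveReductionAt_of_dvd`) and
`δ = 0` at an additive place (`LocalDeltaCalculus.delta_of_hasAdditiveReductionAt`).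
[cite: GreenbergVatsal2000, §2 Prop. (2.4) (p. 22) and p. 27 (Euler factor 1 at an additive place)] -/
theorem balanceTerm_eq_zero_of_hasAdditiveReductionAt_of_dvd {v : HeightOneSpectrum (𝓞 ℚ)}
    (hpv : ((p : ℕ) : 𝓞 ℚ) ∉ v.asIdeal) (hadd : W.HasAdditiveReductionAt v)
    {Φ₀ : AddSubgroup (geomTorsion W (p : ℤ))} (hΦ : IsRationalLine W p Φ₀)
    {m : ℕ} [NeZero m] {φ : DirichletCharacter (ZMod p) m} (hφ : φ.IsPrimitive)
    {d : ℕ} [NeZero d] {ψ : DirichletCharacter (ZMod p) d} (hψ : ψ.IsPrimitive)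
    (hφ0 : ∀ (σ : absoluteGaloisGroup ℚ), ∀ P ∈ Φ₀,
      σ • P = (φ ((modNCyclotomicCharacter ℚ m σ : (ZMod m)ˣ) : ZMod m)).val • P)
    (hψ0 : ∀ (σ : absoluteGaloisGroup ℚ) (Q : geomTorsion W (p : ℤ)),
      σ • Q - (ψ ((modNCyclotomicCharacter ℚ d σ : (ZMod d)ˣ) : ZMod d)).val • Q ∈ Φ₀)
    (hℓm : Rat.HeightOneSpectrum.natGenerator v ∣ m) :
    ((if φ (Rat.HeightOneSpectrum.natGenerator v : ZMod m) =
          (Rat.HeightOneSpectrum.natGenerator v : ZMod p)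
        then sFactor p (Rat.HeightOneSpectrum.natGenerator v) else 0) +
      (if ψ (Rat.HeightOneSpectrum.natGenerator v : ZMod d) =
          (Rat.HeightOneSpectrum.natGenerator v : ZMod p)
        then sFactor p (Rat.HeightOneSpectrum.natGenerator v) else 0)) = 0 ∧
      delta W p v = 0 := by
  have hℓp : Rat.HeightOneSpectrum.natGenerator v ≠ p := fun h ↦ not_natGenerator_dvd hpv (h ▸ dvd_rfl)
  have hℓd : Rat.HeightOneSpectrum.natGenerator v ∣ d :=
    (dvd_iff_dvd_of_isPrimitive hΦ φ ψ hφ0 hψ0 hφ hψ (Rat.HeightOneSpectrum.prime_natGenerator v) hℓp).mp hℓm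
  have hδ : delta W p v = 0 := LocalDeltaCalculus.delta_of_hasAdditiveReductionAt hadd
  refine ⟨?_, hδ⟩
  rw [balanceTerm_of_hasAdditiveReductionAt_of_dvd hℓp hadd φ hℓm ψ hℓd, hδ]

/-! ## §2. `p = 3`: the balance over `S₀` with everything class-wide EVALUATED -/

/-- **The REDUCED balance (`p = 3`).** For a finite `S₀ ∌ (3)` and `A ⊆ S₀` with every place of `A` ADDITIVE and every
place of `S₀ ∖ A` MULTIPLICATIVE for the globally minimal `W`, and any rational `3`-line with primitive presenting
characters `(φ mod m, ψ mod d)`: for every `n`,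
`n + Σ_{S₀} δ = Σ_{S₀} term ↔ n = Σ_{v ∈ S₀ ∖ A} s_ℓ·[W split at v] + Σ_{v ∈ A} (0 if ℓ_v ∣ m, term(v) otherwise)`
(w3 g10's `balance_iff_at_three` + §1 + `δ = 0` on `A`). [cite: GreenbergVatsal2000, §2 Prop. (2.4) (p. 22) and §3 p. 43] -/
theorem balance_iff_reduced_at_three [W.IsGloballyMinimal] {S₀ A : Finset (HeightOneSpectrum (𝓞 ℚ))} (hAS : A ⊆ S₀)
    (hS₀p : ∀ v ∈ S₀, ((3 : ℕ) : 𝓞 ℚ) ∉ v.asIdeal)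
    (hA : ∀ v ∈ A, W.HasAdditiveReductionAt v)
    (hmult : ∀ v ∈ S₀, v ∉ A → W.HasMultiplicativeReductionAt v)
    {Φ₀ : AddSubgroup (geomTorsion W (3 : ℤ))} (hΦ : IsRationalLine W 3 Φ₀)
    {m : ℕ} [NeZero m] {φ : DirichletCharacter (ZMod 3) m} (hφ : φ.IsPrimitive)
    {d : ℕ} [NeZero d] {ψ : DirichletCharacter (ZMod 3) d} (hψ : ψ.IsPrimitive)
    (hφ0 : ∀ (σ : absoluteGaloisGroup ℚ), ∀ P ∈ Φ₀,
      σ • P = (φ ((modNCyclotomicCharacter ℚ m σ : (ZMod m)ˣ) : ZMod m)).val • P)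
    (hψ0 : ∀ (σ : absoluteGaloisGroup ℚ) (Q : geomTorsion W (3 : ℤ)),
      σ • Q - (ψ ((modNCyclotomicCharacter ℚ d σ : (ZMod d)ˣ) : ZMod d)).val • Q ∈ Φ₀) (n : ℕ) :
    (n + ∑ v ∈ S₀, delta W 3 v =
      ∑ v ∈ S₀, ((if φ (Rat.HeightOneSpectrum.natGenerator v : ZMod m) =
            (Rat.HeightOneSpectrum.natGenerator v : ZMod 3)
          then sFactor 3 (Rat.HeightOneSpectrum.natGenerator v) else 0) +
        (if ψ (Rat.HeightOneSpectrum.natGenerator v : ZMod d) =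
            (Rat.HeightOneSpectrum.natGenerator v : ZMod 3)
          then sFactor 3 (Rat.HeightOneSpectrum.natGenerator v) else 0))) ↔
    (n = ∑ v ∈ S₀ \ A, (if W.HasSplitMultiplicativeReductionAt v
          then sFactor 3 (Rat.HeightOneSpectrum.natGenerator v) else 0) +
      ∑ v ∈ A, (if Rat.HeightOneSpectrum.natGenerator v ∣ m then 0 else
        ((if φ (Rat.HeightOneSpectrum.natGenerator v : ZMod m) =
            (Rat.HeightOneSpectrum.natGenerator v : ZMod 3)
          then sFactor 3 (Rat.HeightOneSpectrum.natGenerator v) else 0) +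
        (if ψ (Rat.HeightOneSpectrum.natGenerator v : ZMod d) =
            (Rat.HeightOneSpectrum.natGenerator v : ZMod 3)
          then sFactor 3 (Rat.HeightOneSpectrum.natGenerator v) else 0)))) := by
  rw [balance_iff_at_three hAS hS₀p hmult hΦ hφ hψ hφ0 hψ0 n]
  -- `δ = 0` on `A`
  have hδA : ∑ v ∈ A, delta W 3 v = 0 :=
    Finset.sum_eq_zero fun v hv ↦ LocalDeltaCalculus.delta_of_hasAdditiveReductionAt (hA v hv)
  -- the raw term on `A` equals the reduced one
  have hT : ∑ v ∈ A, ((if φ (Rat.HeightOneSpectrum.natGenerator v : ZMod m) =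
            (Rat.HeightOneSpectrum.natGenerator v : ZMod 3)
          then sFactor 3 (Rat.HeightOneSpectrum.natGenerator v) else 0) +
        (if ψ (Rat.HeightOneSpectrum.natGenerator v : ZMod d) =
            (Rat.HeightOneSpectrum.natGenerator v : ZMod 3)
          then sFactor 3 (Rat.HeightOneSpectrum.natGenerator v) else 0)) =
      ∑ v ∈ A, (if Rat.HeightOneSpectrum.natGenerator v ∣ m then 0 else
        ((if φ (Rat.HeightOneSpectrum.natGenerator v : ZMod m) =
            (Rat.HeightOneSpectrum.natGenerator v : ZMod 3)
          then sFactor 3 (Rat.HeightOneSpectrum.natGenerator v) else 0) +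
        (if ψ (Rat.HeightOneSpectrum.natGenerator v : ZMod d) =
            (Rat.HeightOneSpectrum.natGenerator v : ZMod 3)
          then sFactor 3 (Rat.HeightOneSpectrum.natGenerator v) else 0))) := by
    refine Finset.sum_congr rfl fun v hv ↦ ?_
    by_cases hℓm : Rat.HeightOneSpectrum.natGenerator v ∣ m
    · rw [if_pos hℓm]
      exact (balanceTerm_eq_zero_of_hasAdditiveReductionAt_of_dvd (hS₀p v (hAS hv)) (hA v hv) hΦ hφ hψ hφ0 hψ0
        hℓm).1
    · rw [if_neg hℓm]
  rw [hδA, hT, add_zero]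

/-! ## §3. The sub-row door with the reduced balance -/

/-- **Stub 6 (∃-PARTNER) at EVERY non-split X2b pair `(W, 3)`, for ANY rational `3`-line, from the REDUCED
balance.** Inputs: `X2.CellB W 3`, `3` non-split; a rational `3`-line `Φ₀` with primitive presenting characters `φ`
mod `m`, `ψ` mod `d` (they exist for every X2 curve: LEAD g11's `exists_lineDatum_of_classX2`); a finite `S₀ ∌ (3)`
off which `W` is good, with a subset `A` of ADDITIVE places outside which `S₀` is MULTIPLICATIVE; and the identity
`1 = Σ_{v ∈ S₀ ∖ A} s_ℓ·[W split at v] + Σ_{v ∈ A, ℓ_v ∤ m} s_ℓ([φ(ℓ) = ℓ̄] + [ψ(ℓ) = ℓ̄])`. Output: the conclusion of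
`stub_upperPartner` at `(W, 3)` VERBATIM (LEAD g11's `upperPartner_at_three_of_line_of_thmE` after §2). Named facts BY
NAME: `PublishedInputs`, Disegni Thm. 4(1), GV Thm. (3.11), Dokchitser, Nakagawa–Horie–Taya (PUB); Keller–Yin Thm. E
(PRE). [claim: KellerYin2024, status: under-review] [cite: GreenbergVatsal2000, §2 Prop. (2.4) and §3 Thm. (3.11) (p. 43)]
[cite: NakagawaHorie1988, Thm. 1] [cite: DokchitserDokchitserAnnals2010, Thm. 1.4] [cite: Disegni2020, Thm. 4 (§3.2)]
[cite: Wuthrich2014, Thm. 16 (p. 397)] -/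
theorem upperPartner_at_three_of_reducedBalance_of_thmE (hP : EisensteinPrimes.PublishedInputs)
    (hDis : padicBSD_rankOne_nonsplitMult) (h311 : thm311_hasUnitContent_iff_and_order_eq_of_lineRamifiedEven)
    (hDD : ∀ (V : WeierstrassCurve ℚ) [V.IsElliptic] (ℓ : ℕ) [Fact ℓ.Prime], selmerCorank_mod_two_eq V ℓ)
    (hKY : thmE_pConverse_semistable_OPEN)
    (hNH : Literature.NumberTheory.QuadraticFields.nakagawaHorie_taya_exists_imaginary_h3_eq_one)
    (W : WeierstrassCurve ℚ) [W.IsElliptic] [W.IsGloballyMinimal]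
    (hc : X2.CellB W 3) (hns : ¬ W.HasSplitMultiplicativeReductionAtPrime 3)
    {Φ₀ : AddSubgroup (geomTorsion W (3 : ℤ))} (hΦ : IsRationalLine W 3 Φ₀)
    {m : ℕ} [NeZero m] (φ : DirichletCharacter (ZMod 3) m) {d : ℕ} [NeZero d]
    (ψ : DirichletCharacter (ZMod 3) d) (hφ : φ.IsPrimitive) (hψ : ψ.IsPrimitive)
    (hφ0 : ∀ (σ : absoluteGaloisGroup ℚ), ∀ P ∈ Φ₀,
      σ • P = (φ ((modNCyclotomicCharacter ℚ m σ : (ZMod m)ˣ) : ZMod m)).val • P)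
    (hψ0 : ∀ (σ : absoluteGaloisGroup ℚ) (P : geomTorsion W (3 : ℤ)),
      σ • P - (ψ ((modNCyclotomicCharacter ℚ d σ : (ZMod d)ˣ) : ZMod d)).val • P ∈ Φ₀)
    (S₀ : Finset (HeightOneSpectrum (𝓞 ℚ))) (hS₀p : ∀ v ∈ S₀, ((3 : ℕ) : 𝓞 ℚ) ∉ v.asIdeal)
    (hS : ∀ v : HeightOneSpectrum (𝓞 ℚ), v ∉ S₀ → ((3 : ℕ) : 𝓞 ℚ) ∉ v.asIdeal → W.HasGoodReductionAt v)
    (A : Finset (HeightOneSpectrum (𝓞 ℚ))) (hAS : A ⊆ S₀) (hA : ∀ v ∈ A, W.HasAdditiveReductionAt v)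
    (hmult : ∀ v ∈ S₀, v ∉ A → W.HasMultiplicativeReductionAt v)
    (hbal : 1 = ∑ v ∈ S₀ \ A, (if W.HasSplitMultiplicativeReductionAt v
          then sFactor 3 (Rat.HeightOneSpectrum.natGenerator v) else 0) +
      ∑ v ∈ A, (if Rat.HeightOneSpectrum.natGenerator v ∣ m then 0 else
        ((if φ (Rat.HeightOneSpectrum.natGenerator v : ZMod m) =
            (Rat.HeightOneSpectrum.natGenerator v : ZMod 3)
          then sFactor 3 (Rat.HeightOneSpectrum.natGenerator v) else 0) +
        (if ψ (Rat.HeightOneSpectrum.natGenerator v : ZMod d) =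
            (Rat.HeightOneSpectrum.natGenerator v : ZMod 3)
          then sFactor 3 (Rat.HeightOneSpectrum.natGenerator v) else 0)))) :
    ∃ (K : Type) (_ : Field K) (_ : NumberField K), IsImaginaryQuadratic K ∧
      SatisfiesHeegnerHypothesis (W.conductorNorm ℤ) K ∧ SatisfiesHeegnerHypothesis 3 K ∧
      Odd (NumberField.discr K) ∧ NumberField.discr K < -4 ∧
      (W.quadraticTwist (NumberField.discr K : ℚ)).analyticRank = 1 ∧
      ∀ (Wd : WeierstrassCurve ℚ) [Wd.IsElliptic] [Wd.IsGloballyMinimal],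
        (∃ C : VariableChange ℚ, C • Wd = W.quadraticTwist (NumberField.discr K : ℚ)) →
        MissingUpperBoundAt Wd 3 :=
  upperPartner_at_three_of_line_of_thmE hP hDis h311 hDD hKY hNH W hc hns hΦ φ ψ hφ hψ hφ0 hψ0 S₀ hS₀p hS
    ((balance_iff_reduced_at_three hAS hS₀p hA hmult hΦ hφ hψ hφ0 hψ0 1).mpr hbal)

end Summit.BirchSwinnertonDyer.BirchSwinnertonDyer.Theorems.EisensteinPrimesMazurMCOnCellBTwistbackSubrowReducedBalance

end
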